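import Literature.AlgebraicGeometry.Frobenioids.ArchimedeanProp35iiiRepaired
import Literature.AlgebraicGeometry.Frobenioids.ArchimedeanProp35FaithfulBases
import HarnessLib

/-!
# Frobenioids II, Proposition 3.5 (iii) REPAIRED: every FAITHFUL base functor of RC-iso-subanchor type is of
# Galois-saturated RC-iso-subanchor type

Mochizuki, *The geometry of Frobenioids II: poly-Frobenioids*, Kyushu J. Math. **62** (2008) 401–460, §3,
Proposition 3.5 (iii) p. 34, Definition 3.1 (v) p. 25 [cite: MochizukiFrdII2008, Prop 3.5 (iii) p.34]
[cite: MochizukiFrdII2008, Def 3.1 (v) p.25].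

PROOF-ONLY bridge (abc-iut cell, layer L1, node `FrdII:Prop3.5(iii)`, seat abc-iut-w4-d027 gen 4) between this
lineage's `ArchimedeanProp35iiiRepaired.lean` (the repaired hypothesis `ArchFrd.IsOfSaturatedRCIsoSubanchorType` and
the repaired statements `Prop35iiiR_N/_R` with their `_holds`) and `ArchimedeanProp35FaithfulBases.lean`
(`galoisSaturated_of_injOn`): over a base functor REFLECTING TRIVIAL AUTOMORPHISMS — in particular a FAITHFUL one —
the printed hypothesis «`D` of RC-iso-subanchor type» ([FrdII] Def. 3.1 (v)(d)) already implies the repaired one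
(**`isOfSaturatedRCIsoSubanchorType_of_reflects`**, **`isOfSaturatedRCIsoSubanchorType_of_faithful`**), so the
repaired and the printed Prop. 3.5 (iii) coincide there (**`isOfSaturatedRCIsoSubanchorType_iff_of_faithful`**).
Nothing here bears on [IUTchIII] Cor. 3.12; no new definition; no side taken.
-/

namespace Literature.AlgebraicGeometry.Frobenioids

open CategoryTheory

noncomputable section

namespace ArchFrd

universe v u

variable {D : Type u} [Category.{v} D] (π : D ⥤ D0)

/-- **Over a base functor `π : D → D₀` REFLECTING TRIVIAL AUTOMORPHISMS, «`D` of RC-iso-subanchor type» (as printed,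
[FrdII] Def. 3.1 (v)(d)) implies «`D` of Galois-SATURATED RC-iso-subanchor type»** (`galoisSaturated_of_injOn`).
[cite: MochizukiFrdII2008, Def 3.1 (v) p.25] -/
theorem isOfSaturatedRCIsoSubanchorType_of_reflects
    (hπ : ∀ ⦃BD : D⦄ (g : Aut BD), π.map g.hom = 𝟙 (π.obj BD) → g = 1)
    (hRC : RC.IsOfRCIsoSubanchorType (baseRC π)) : IsOfSaturatedRCIsoSubanchorType π :=
  ⟨fun AD => by
    obtain ⟨BD, GD, fD, hB, hq⟩ := hRC.isRCIsoSubanchor AD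
    exact ⟨BD, GD, fD, hB, hq, galoisSaturated_of_injOn π fD GD hq.1 fun g _ hg => hπ g hg⟩⟩

/-- **Over a FAITHFUL base functor `π : D → D₀`, «`D` of RC-iso-subanchor type» (as printed) implies «`D` of
Galois-SATURATED RC-iso-subanchor type».** [cite: MochizukiFrdII2008, Def 3.1 (v) p.25] -/
theorem isOfSaturatedRCIsoSubanchorType_of_faithful [π.Faithful] (hRC : RC.IsOfRCIsoSubanchorType (baseRC π)) :
    IsOfSaturatedRCIsoSubanchorType π :=
  isOfSaturatedRCIsoSubanchorType_of_reflects π (fun _ g hg => eq_one_of_map_hom_eq_id_of_faithful π g hg) hRC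

/-- **Over a FAITHFUL base functor the printed and the repaired hypotheses of Prop. 3.5 coincide**: `D` is of
RC-iso-subanchor type iff it is of Galois-saturated RC-iso-subanchor type. [cite: MochizukiFrdII2008, Def 3.1 (v) p.25] -/
theorem isOfSaturatedRCIsoSubanchorType_iff_of_faithful [π.Faithful] :
    IsOfSaturatedRCIsoSubanchorType π ↔ RC.IsOfRCIsoSubanchorType (baseRC π) :=
  ⟨fun h => h.isOfRCIsoSubanchorType, isOfSaturatedRCIsoSubanchorType_of_faithful π⟩

/-- **THE base of [IUTchI] Ex. 3.4 (i) via the faithful route**: `ptBase` is faithful (`ptBase_faithful`) and of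
RC-iso-subanchor type, hence of Galois-saturated RC-iso-subanchor type (agrees with
`isOfSaturatedRCIsoSubanchorType_ptBase`). [cite: Mochizuki2012, Ex 3.4 (i) p.80] -/
theorem isOfSaturatedRCIsoSubanchorType_ptBase' : IsOfSaturatedRCIsoSubanchorType ptBase :=
  haveI := ptBase_faithful
  isOfSaturatedRCIsoSubanchorType_of_faithful ptBase ptBase_isOfRCIsoSubanchorType

end ArchFrd

end

end Literature.AlgebraicGeometry.Frobenioids
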